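import Summits.QuantumAdvantage.AdviceFreeQNC0.AffBells22FrameAveragingOne
import Summits.QuantumAdvantage.AdviceFreeQNC0.AffBells22KernelLineParity
import HarnessLib

/-!
# Sketch22 §2: the rung `RingFrameAffineLt3` (R-frame) and `FramePlan`, proved

The planner's rung candidate (Sketch22 §2, statements copied verbatim: `frameBell`, `RingFrameAffineLt3`,
`FramePlan`): affine MOD₃ outputs `z_k(x) = [⟨M_k V, x⟩ ≡ c_k]` whose rows lie in a `δN`-regular frame `V` of
dimension `m ≤ μ₀(δ)·N` satisfy the ring relation on at most `θ·2^{N−1}` odd patterns, `θ < 1`.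

Proof (the §2c route, not the §2 second-moment route): an affine frame strategy is the frame ⊗ junta strategy
of the affine table `τ_k(y, x) = [Σ_l M_{kl} y_l = c_k]`, which reads NO input bit
(`frameBell_eq_frameJuntaBell`); by `frameAveragingOne` (frame averaging for `1`-junta tables,
`AffBells22FrameAveragingOne`) it wins at most `ε·2^{N−1}` more often than the average of its frozen
strategies, and every frozen strategy is a junta (here: constant) strategy, losing a constant fraction by
`juntaHard` (a corollary of the tree theorem `ringHardOdd_two`).  This gives the rung for ALL `1`-junta tables
(`ringFrameJuntaOneLt3`, the `w₀ ≤ 1` case of `RingFrameJuntaLt3`) and in particular `ringFrameAffineLt3`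
(the non-constancy hypothesis `∃ k, M_k ≠ 0` is not needed).  `FramePlan` follows outright; its four inputs are
theorems of the tree anyway (`framePlan_inputs`).

WHAT THIS IS NOT: the general-`w₀` rung `RingFrameJuntaLt3` needs `FrameAveraging` for `w₀`-junta tables
(`Mod3VsLowDegree` in the error term), which is not proved here; nothing here touches the crux `RingDenseResidualLt3`.
-/

namespace Summit.QuantumAdvantage.AdviceFreeQNC0

open Finset Literature.Computability.QuantumComplexity Literature.Computability.QuantumComplexity.RingHLF
open Literature.Computability.MetaComplexity

namespace AffBells22

/-! ## The statements (planner's Sketch22 §2, verbatim) -/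

/-- Affine FRAME outputs: `z_k(x) = [⟨M_k·V, x⟩ ≡ c_k (mod 3)]`. -/
def frameBell {N m : ℕ} (V : Fin m → Fin N → ZMod 3) (M : Fin N → Fin m → ZMod 3) (c : Fin N → ZMod 3)
    (x : Fin N → Bool) (k : Fin N) : Bool :=
  decide ((∑ i : Fin N, if x i then (∑ l : Fin m, M k l * V l i) else 0) = c k)

/-- **RUNG CANDIDATE `RingFrameAffineLt3` (R-frame)** — affine MOD₃ outputs whose rows lie in a `δN`-REGULAR frame of dimension
`m ≤ μ₀(δ)·N` (at least one non-constant bell) satisfy the ring relation on at most `θ·2^{N−1}` odd patterns, `θ = θ(δ) < 1`.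
Covers at once: `K ≤ μ₀N` regular forms with affine tables (beyond `RingLinFormsLt3`'s `K ≤ (log₂N)^C` for this table class),
projective gadgets and their products, pool systems, the near-identity zoo of §1 — with NO per-fibre certification.
Proof plan: §2 docstring + `KernelLineParityBias` + `KernelZerosOnSetMGF` + `KernelZerosMGF` + `SpanPhiBound` on a class. -/
def RingFrameAffineLt3 : Prop :=
  open scoped Classical in
  ∀ δ : ℝ, 0 < δ → ∃ μ₀ : ℝ, 0 < μ₀ ∧ ∃ θ : ℝ, θ < 1 ∧ ∃ n₀ : ℕ, ∀ N ≥ n₀, ∀ m : ℕ, (m : ℝ) ≤ μ₀ * N →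
    ∀ (V : Fin m → Fin N → ZMod 3) (M : Fin N → Fin m → ZMod 3) (c : Fin N → ZMod 3),
      (∀ t : Fin m → ZMod 3, t ≠ 0 → δ * N ≤ ((univ.filter fun i : Fin N => (∑ l : Fin m, t l * V l i) ≠ 0).card : ℝ)) →
      (∃ k, M k ≠ 0) →
      ((univ.filter fun x : Fin N → Bool => OddZeros x ∧ RingHLF.Rel x (frameBell V M c x)).card : ℝ)
        ≤ θ * (2 : ℝ) ^ (N - 1)

/-- **THE FRAME PLAN** (assembly of §2 as one implication for provers; the class version of SPAN-Φ and the fibre dictionary are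
used inside): the three kernel-line moment bounds and the frame expansion give the rung. -/
def FramePlan : Prop :=
  KernelLineParityBias → KernelZerosOnSetMGF → KernelZerosMGF → SpanPhiBound → RingFrameAffineLt3

/-! ## The rung for `1`-junta tables (unconditional) -/

/-- **RUNG `RingFrameJuntaLt3` FOR `w₀ ≤ 1`, PROVED**: every strategy whose outputs are arbitrary functions of a `δN`-regular frame value of
dimension `m ≤ μ₀N` and of at most ONE own input bit satisfies the ring relation on at most `θ·2^{N−1}` odd patterns, `θ = (1 + θ₂)/2 < 1`
(`frameAveragingOne` + junta hardness `juntaHard`, itself a corollary of `ringHardOdd_two`). -/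
theorem ringFrameJuntaOneLt3 :
    ∀ δ : ℝ, 0 < δ → ∃ μ₀ : ℝ, 0 < μ₀ ∧ ∃ θ : ℝ, θ < 1 ∧ ∃ n₀ : ℕ, ∀ N ≥ n₀, ∀ m : ℕ, (m : ℝ) ≤ μ₀ * N →
      ∀ (V : Fin m → Fin N → ZMod 3) (T : Fin N → Finset (Fin N))
        (τ : Fin N → (Fin m → ZMod 3) → (Fin N → Bool) → Bool),
        (∀ t : Fin m → ZMod 3, t ≠ 0 →
          δ * N ≤ ((univ.filter fun i : Fin N => (∑ l : Fin m, t l * V l i) ≠ 0).card : ℝ)) →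
        (∀ k, (T k).card ≤ 1) → (∀ k y, ReadsOnly (T k) (τ k y)) →
        (winCount (frameJuntaBell V τ) : ℝ) ≤ θ * (2 : ℝ) ^ (N - 1) := by
  intro δ hδ
  obtain ⟨θ₂, hθ₂, hjunta⟩ := juntaHard
  obtain ⟨n₁, hn₁⟩ := hjunta 1
  set ε : ℝ := (1 - θ₂) / 2 with hε
  have hεpos : 0 < ε := by rw [hε]; linarith
  obtain ⟨μ₀, hμ₀, n₂, hn₂⟩ := frameAveragingOne δ hδ ε hεpos
  refine ⟨μ₀, hμ₀, θ₂ + ε, by rw [hε]; linarith, max n₁ n₂, fun N hN m hm V T τ hreg hT hread => ?_⟩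
  have hN₁ : n₁ ≤ N := le_trans (le_max_left _ _) hN
  have hN₂ : n₂ ≤ N := le_trans (le_max_right _ _) hN
  have havg := hn₂ N hN₂ m hm V T τ hreg hT hread
  have hfrozen : ∀ u : Fin m → ZMod 3, (winCount (frozenBell τ u) : ℝ) ≤ θ₂ * (2 : ℝ) ^ (N - 1) :=
    fun u => hn₁ N hN₁ T (fun k => τ k u) hT (fun k => hread k u)
  have hsum : (∑ u : Fin m → ZMod 3, (winCount (frozenBell τ u) : ℝ)) / (3 : ℝ) ^ m ≤ θ₂ * (2 : ℝ) ^ (N - 1) := by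
    rw [div_le_iff₀ (by positivity)]
    calc ∑ u : Fin m → ZMod 3, (winCount (frozenBell τ u) : ℝ)
        ≤ ∑ _u : Fin m → ZMod 3, θ₂ * (2 : ℝ) ^ (N - 1) := sum_le_sum fun u _ => hfrozen u
      _ = θ₂ * (2 : ℝ) ^ (N - 1) * (3 : ℝ) ^ m := by
          rw [sum_const, card_univ, card_frame, nsmul_eq_mul]
          push_cast
          ring
  calc (winCount (frameJuntaBell V τ) : ℝ)
      ≤ (∑ u : Fin m → ZMod 3, (winCount (frozenBell τ u) : ℝ)) / (3 : ℝ) ^ m + ε * (2 : ℝ) ^ (N - 1) := havg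
    _ ≤ θ₂ * (2 : ℝ) ^ (N - 1) + ε * (2 : ℝ) ^ (N - 1) := by linarith
    _ = (θ₂ + ε) * (2 : ℝ) ^ (N - 1) := by ring

/-! ## The affine frame rung -/

/-- The affine table `τ_k(y, x) = [Σ_l M_{kl} y_l = c_k]` (reads no input bit). -/
def affineTable {N m : ℕ} (M : Fin N → Fin m → ZMod 3) (c : Fin N → ZMod 3)
    (k : Fin N) (y : Fin m → ZMod 3) (_x : Fin N → Bool) : Bool :=
  decide ((∑ l : Fin m, M k l * y l) = c k)

/-- An affine frame strategy is the frame ⊗ junta strategy of its affine table: `⟨M_k V, x⟩ = Σ_l M_{kl} (Vx)_l`. -/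
theorem frameBell_eq_frameJuntaBell {N m : ℕ} (V : Fin m → Fin N → ZMod 3) (M : Fin N → Fin m → ZMod 3)
    (c : Fin N → ZMod 3) : frameBell V M c = frameJuntaBell V (affineTable M c) := by
  funext x k
  unfold frameBell frameJuntaBell affineTable
  rw [sum_mul_frameVal]

/-- The affine table reads no input bit. -/
theorem readsOnly_affineTable {N m : ℕ} (M : Fin N → Fin m → ZMod 3) (c : Fin N → ZMod 3) (k : Fin N)
    (y : Fin m → ZMod 3) : ReadsOnly (∅ : Finset (Fin N)) (affineTable M c k y) :=
  fun _ _ _ => rfl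

/-- **RUNG `RingFrameAffineLt3` (R-frame) PROVED** — unconditionally, and without the non-constancy hypothesis: an affine MOD₃ strategy over
a `δN`-regular frame of dimension `m ≤ μ₀N` is a frame ⊗ `0`-junta strategy, so `ringFrameJuntaOneLt3` applies (its frozen strategies are
the CONSTANT strategies, which lose a constant fraction by `ringHardOdd_two`). -/
theorem ringFrameAffineLt3 : RingFrameAffineLt3 := by
  intro δ hδ
  obtain ⟨μ₀, hμ₀, θ, hθ, n₀, hn₀⟩ := ringFrameJuntaOneLt3 δ hδ
  refine ⟨μ₀, hμ₀, θ, hθ, n₀, fun N hN m hm V M c hreg _ => ?_⟩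
  have h := hn₀ N hN m hm V (fun _ => ∅) (affineTable M c) hreg (fun _ => by simp)
    (fun k y => readsOnly_affineTable M c k y)
  rw [← frameBell_eq_frameJuntaBell] at h
  refine le_of_eq_of_le ?_ h
  unfold winCount
  congr

/-- **THE FRAME PLAN, DISCHARGED**: all four hypotheses are theorems of the tree (`kernelLineParityBias`, `kernelZerosOnSetMGF`,
`kernelZerosMGF`, `spanPhiBound`) and the conclusion holds outright (`ringFrameAffineLt3`). -/
theorem framePlan : FramePlan := fun _ _ _ _ => ringFrameAffineLt3

/-- The four inputs of the frame plan, for the record. -/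
theorem framePlan_inputs : KernelLineParityBias ∧ KernelZerosOnSetMGF ∧ KernelZerosMGF ∧ SpanPhiBound :=
  ⟨kernelLineParityBias, kernelZerosOnSetMGF, kernelZerosMGF, spanPhiBound⟩

end AffBells22

end Summit.QuantumAdvantage.AdviceFreeQNC0
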